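import Mathlib
import Summits.ValiantsHypothesis.ValiantsHypothesis.Theorems.LacunarySymmetroidMatrixDescartesDoorA26WallBubblingBubblingCount
import Summits.ValiantsHypothesis.ValiantsHypothesis.Theorems.LacunarySymmetroidMatrixDescartesDoorA26WallBubblingBubblingNormalisation
import Summits.ValiantsHypothesis.ValiantsHypothesis.Theorems.LacunarySymmetroidMatrixDescartesDoorA26WallBubblingBubblingInertiaClosed

/-!
# The assembly: cluster limits exist; obligation (B) proved (S3a–c) — turnkey helper, val-idea-15

Module of the BUBBLING REDUCTION for obligation (B) `Stmt.stub_bubbling` of the line `Cruxes/DoorA26/Lines/wall_bubbling.lean`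
(stmt-ValiantsHypothesis-19979, `Theses.LacunarySymmetroid.DoorA26`).  Contents: `zeros_of_mem_twentyLocus` (S3a), `blocks` (S3b), `realisable_recentred`, `clusterLimit_of_data` (S3c: recentring, max-normalisation,
Bolzano–Weierstrass, transfer identities, realisability of the limits), `clusterLimit_of_mem_closure` (S3), `stub_bubbling_proof :
Stmt.stub_bubbling` and `stub_bubbling_inlined` (every project definition unfolded). [this work]

HONEST FRAMING / PROVENANCE.  Turnkey port of ideator val-idea-15 g1 (crux workfile `Cruxes/DoorA26/Lines/wall_bubbling_Assembly.lean`, commit d4cb61350496, ZERO `sorry`; split into ≤ 400-line modules, one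
namespace `…WallBubbling.Bubbling`, single copies of the definitions), filed by prover seat val-port-4 g1 (val-lit port pool; desk g12 RULING #266 (b), director R166/R168) with `--supports stmt-ValiantsHypothesis-19979 --as helper`.
Mathlib-only mathematics (elementary real analysis, linear algebra, finite combinatorics); nothing here bears on `DoorA26` (OPEN; obligations (W), (M), (R) of the line remain),
on `MatrixDescartes` (stmt-ValiantsHypothesis-18050) or on `VP ≠ VNP`.
-/

-- `Summit.ValiantsHypothesis.ValiantsHypothesis.…` repeats a component by the D-0017 layout
-- (single-conjunct summit), which the `dupNamespace` linter flags; the name is mandated.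
set_option linter.dupNamespace false

namespace Summit.ValiantsHypothesis.ValiantsHypothesis.Theorems.LacunarySymmetroidMatrixDescartes.WallBubbling.Bubbling

open Finset Filter Topology

/-! ## S3a — unpacking the twenty-locus (B5) -/

/-- Recentring/rescaling an exponential sum. [this work] -/
theorem expSum_recenter (G x : Pair → ℝ) (r s t : ℝ) :
    expSum (fun p => r * (G p * Real.exp (x p * s))) x t = r * expSum G x (t + s) := by
  unfold expSum
  rw [Finset.mul_sum]
  refine Finset.sum_congr rfl fun p _ => ?_
  rw [mul_add, Real.exp_add]
  ring

/-- The pencil determinant along `x = exp t` is the `expSum` of the polar Gram coefficients over the members. [this work] -/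
theorem det_pencil_exp (δ : Fin 6 → ℝ) (S : Fin 6 → Matrix (Fin 2) (Fin 2) ℝ) (t : ℝ) :
    (∑ l, ((Real.exp t) ^ (δ l)) • S l).det = expSum (fun p : Pair => polar (S p.1) (S p.2)) (pairExp δ) t := by
  rw [det_rpow_pencil δ S (Real.exp_pos t)]
  unfold expSum pairExp
  rw [← Finset.sum_product']
  refine Finset.sum_congr rfl fun p _ => ?_
  rw [rpow_exp_eq]

/-- **S3a.**  A point of the twenty-locus yields symmetric letters with a NONZERO polar Gram vector and `20` strictly increasing
real zeros of the associated `expSum`. [folklore] -/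
theorem zeros_of_mem_twentyLocus {δ : Fin 6 → ℝ} (hδ : δ ∈ TwentyLocus) :
    ∃ S : Fin 6 → Matrix (Fin 2) (Fin 2) ℝ, (∀ l, (S l).IsSymm) ∧
      (fun p : Pair => polar (S p.1) (S p.2)) ≠ 0 ∧
      ∃ z : Fin 20 → ℝ, StrictMono z ∧ ∀ j, expSum (fun p : Pair => polar (S p.1) (S p.2)) (pairExp δ) (z j) = 0 := by
  classical
  obtain ⟨S, hS, h20⟩ := hδ
  set Zpos : Set ℝ := {x : ℝ | 0 < x ∧ (∑ l, (x ^ (δ l)) • S l).det = 0} with hZpos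
  refine ⟨S, hS, ?_, ?_⟩
  · -- nonzero Gram vector: otherwise the determinant vanishes on `(0, ∞)` and `ncard = 0`
    intro hG
    have hall : ∀ x : ℝ, 0 < x → (∑ l, (x ^ (δ l)) • S l).det = 0 := by
      intro x hx
      rw [det_rpow_pencil δ S hx]
      refine Finset.sum_eq_zero fun k _ => Finset.sum_eq_zero fun l _ => ?_
      have := congrFun hG (k, l)
      simp only [Pi.zero_apply] at this
      rw [this, zero_mul]
    have hIoi : Zpos = Set.Ioi 0 := by
      ext x
      simp only [hZpos, Set.mem_setOf_eq, Set.mem_Ioi]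
      exact ⟨fun h => h.1, fun h => ⟨h, hall x h⟩⟩
    have : Zpos.ncard = 0 := by rw [hIoi]; exact (Set.Ioi_infinite 0).ncard
    rw [this] at h20
    omega
  · -- twenty sorted positive zeros, then logarithms
    obtain ⟨T, hTsub, hTcard⟩ := Set.exists_subset_card_eq h20
    have hTfin : T.Finite := Set.finite_of_ncard_pos (by omega)
    set TF : Finset ℝ := hTfin.toFinset with hTF
    have hTFcard : TF.card = 20 := by
      rw [hTF, ← Set.ncard_eq_toFinset_card T hTfin]; exact hTcard
    let e : Fin 20 ↪o ℝ := TF.orderEmbOfFin hTFcard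
    have heT : ∀ j, e j ∈ T := fun j => by
      have h2 : e j ∈ hTfin.toFinset := Finset.orderEmbOfFin_mem TF hTFcard j
      exact hTfin.mem_toFinset.mp h2
    have hepos : ∀ j, 0 < e j := fun j => (hTsub (heT j)).1
    refine ⟨fun j => Real.log (e j), ?_, ?_⟩
    · intro i j hij
      exact Real.log_lt_log (hepos i) (e.strictMono hij)
    · intro j
      have hz := (hTsub (heT j)).2
      rw [← det_pencil_exp, Real.exp_log (hepos j)]
      exact hz

/-! ## S3b — blocks of zeros (B4 + B6 bookkeeping) -/

/-- **Blocks.**  For strictly increasing `20`-point configurations `z ν` there are: a subsequence `φ`, a number `C` of blocks,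
block START indices `start : Fin C → Fin 20` (strictly increasing), a block assignment `blk : Fin 20 → Fin C` with
`start (blk j) ≤ j`, and a radius `R`, such that every point stays within `R` above the start of its block and the starts of
different blocks drift apart to `+∞`. [folklore: Bolzano–Weierstrass bookkeeping] -/
theorem blocks (z : ℕ → Fin 20 → ℝ) (hz : ∀ ν, StrictMono (z ν)) :
    ∃ φ : ℕ → ℕ, StrictMono φ ∧ ∃ (C : ℕ) (start : Fin C → Fin 20) (blk : Fin 20 → Fin C) (R : ℝ),
      StrictMono start ∧ (∀ j, start (blk j) ≤ j) ∧
      (∀ ν j, z (φ ν) j - z (φ ν) (start (blk j)) ∈ Set.Icc (-R) R) ∧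
      (∀ c c', c < c' → Tendsto (fun ν => z (φ ν) (start c') - z (φ ν) (start c)) atTop atTop) := by
  classical
  obtain ⟨φ, hφ, B, hB⟩ := cluster_dichotomy (N := 19) z
  -- unbounded gaps
  set U : Finset (Fin 19) := Finset.univ.filter fun k => ¬ ∀ n, z (φ n) k.succ - z (φ n) k.castSucc ≤ B with hU
  have hUb : ∀ k, k ∉ U → ∀ n, z (φ n) k.succ - z (φ n) k.castSucc ≤ B := by
    intro k hk
    by_contra h
    exact hk (Finset.mem_filter.mpr ⟨Finset.mem_univ _, h⟩)
  have hUt : ∀ k, k ∈ U → Tendsto (fun n => z (φ n) k.succ - z (φ n) k.castSucc) atTop atTop := by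
    intro k hk
    rcases hB k with h | h
    · exact absurd h (Finset.mem_filter.mp hk).2
    · exact h
  -- block starts
  set T : Finset (Fin 20) := insert 0 (U.image Fin.succ) with hT
  set C := T.card with hC
  let start : Fin C ↪o Fin 20 := T.orderEmbOfFin hC.symm
  have hstartT : ∀ c, start c ∈ T := fun c => Finset.orderEmbOfFin_mem T hC.symm c
  have hTstart : ∀ t ∈ T, ∃ c, start c = t := by
    intro t ht
    have : t ∈ Set.range (T.orderEmbOfFin hC.symm) := by rw [Finset.range_orderEmbOfFin]; exact ht
    obtain ⟨c, hc⟩ := this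
    exact ⟨c, hc⟩
  have h0T : (0 : Fin 20) ∈ T := Finset.mem_insert_self _ _
  -- block assignment
  have hne : ∀ j : Fin 20, (Finset.univ.filter fun c : Fin C => start c ≤ j).Nonempty := by
    intro j
    obtain ⟨c₀, hc₀⟩ := hTstart 0 h0T
    exact ⟨c₀, Finset.mem_filter.mpr ⟨Finset.mem_univ _, by rw [hc₀]; exact Fin.zero_le _⟩⟩
  let blk : Fin 20 → Fin C := fun j => (Finset.univ.filter fun c : Fin C => start c ≤ j).max' (hne j)
  have hblk1 : ∀ j, start (blk j) ≤ j := fun j =>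
    (Finset.mem_filter.mp (Finset.max'_mem _ (hne j))).2
  have hblk2 : ∀ j c', start c' ≤ j → c' ≤ blk j := fun j c' h =>
    Finset.le_max' (Finset.univ.filter fun c : Fin C => start c ≤ j) c'
      (Finset.mem_filter.mpr ⟨Finset.mem_univ _, h⟩)
  -- gaps inside a block are bounded gaps
  have hinside : ∀ (j : Fin 20) (k : Fin 19), start (blk j) ≤ k.castSucc → k.succ ≤ j → k ∉ U := by
    intro j k h1 h2 hkU
    have hkT : k.succ ∈ T := Finset.mem_insert_of_mem (Finset.mem_image_of_mem _ hkU)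
    obtain ⟨c', hc'⟩ := hTstart _ hkT
    have hc'le : c' ≤ blk j := hblk2 j c' (by rw [hc']; exact h2)
    have : start c' ≤ start (blk j) := start.monotone hc'le
    rw [hc'] at this
    have h3 : (k.castSucc : Fin 20) < k.succ := Fin.castSucc_lt_succ
    exact absurd (lt_of_lt_of_le h3 (le_trans this h1)) (lt_irrefl _)
  refine ⟨φ, hφ, C, start, blk, 19 * |B|, start.strictMono, hblk1, ?_, ?_⟩
  · -- the window
    intro ν j
    set i₀ := start (blk j) with hi₀
    have hmono : Monotone (z (φ ν)) := (hz (φ ν)).monotone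
    have hlow : 0 ≤ z (φ ν) j - z (φ ν) i₀ := sub_nonneg.mpr (hmono (hblk1 j))
    -- telescoping along `u n = z (φ ν) n` (extended by `0` beyond `19`)
    let u : ℕ → ℝ := fun n => if h : n < 20 then z (φ ν) ⟨n, h⟩ else 0
    have hu : ∀ (q : Fin 20), u q.val = z (φ ν) q := by
      intro q
      simp only [u, dif_pos q.isLt]
    have hgap : ∀ k : ℕ, i₀.val ≤ k → k < j.val → u (k + 1) - u k ≤ B := by
      intro k hk hkj
      have hk19 : k < 19 := by have := j.isLt; omega
      set kf : Fin 19 := ⟨k, hk19⟩ with hkf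
      have hnot : kf ∉ U := hinside j kf (by rw [Fin.le_def]; simpa [hkf] using hk)
        (by rw [Fin.le_def]; simp [hkf]; omega)
      have := hUb kf hnot ν
      have e1 : u (k + 1) = z (φ ν) kf.succ := by
        have := hu kf.succ; simpa [hkf] using this
      have e2 : u k = z (φ ν) kf.castSucc := by
        have := hu kf.castSucc; simpa [hkf] using this
      rw [e1, e2]; exact this
    have htel := telescoping_bound u B i₀.val j.val (hblk1 j) hgap
    rw [hu j, hu i₀] at htel
    have hdiff : ((j.val - i₀.val : ℕ) : ℝ) ≤ 19 := by
      have := j.isLt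
      exact_mod_cast (by omega : j.val - i₀.val ≤ 19)
    refine ⟨by linarith [abs_nonneg B], ?_⟩
    calc z (φ ν) j - z (φ ν) i₀ ≤ ((j.val - i₀.val : ℕ) : ℝ) * B := htel
      _ ≤ ((j.val - i₀.val : ℕ) : ℝ) * |B| := by
          exact mul_le_mul_of_nonneg_left (le_abs_self B) (by positivity)
      _ ≤ 19 * |B| := mul_le_mul_of_nonneg_right hdiff (abs_nonneg B)
  · -- starts drift apart
    intro c c' hcc'
    have hlt : start c < start c' := start.strictMono hcc'
    have hT' : start c' ∈ T := hstartT c'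
    rw [hT, Finset.mem_insert, Finset.mem_image] at hT'
    rcases hT' with h0 | ⟨k, hkU, hk⟩
    · exact absurd (lt_of_lt_of_le hlt (by rw [h0]; exact Fin.zero_le _)) (lt_irrefl _)
    · -- `start c ≤ k.castSucc < k.succ = start c'`
      have hle : start c ≤ k.castSucc := by
        rw [← hk] at hlt
        rw [Fin.le_def]; rw [Fin.lt_def] at hlt
        simp [Fin.val_succ] at hlt ⊢; omega
      refine tendsto_atTop_mono (fun ν => ?_) (hUt k hkU)
      rw [← hk]
      have := (hz (φ ν)).monotone hle
      linarith

/-! ## S3c — normalisation, limits, realisability (B5, B7, B11) -/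

/-- `polar` is bilinear in scalars. [this work] -/
theorem polar_smul_left_right (a b : ℝ) (S T : Matrix (Fin 2) (Fin 2) ℝ) :
    polar (a • S) (b • T) = a * b * polar S T := by
  rw [polar_apply, polar_apply]
  simp only [Matrix.smul_apply, smul_eq_mul]
  ring

/-- A recentred, rescaled polar Gram vector is realisable (letters `Sₗ ↦ exp(δₗ s) • Sₗ`, then scale). [this work] -/
theorem realisable_recentred (δ : Fin 6 → ℝ) (S : Fin 6 → Matrix (Fin 2) (Fin 2) ℝ) (hS : ∀ l, (S l).IsSymm)
    (r s : ℝ) :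
    Realisable (Matrix.of fun k l => r * (polar (S k) (S l) * Real.exp (pairExp δ (k, l) * s))) := by
  have h1 : Realisable (Matrix.of fun k l => polar (Real.exp (δ k * s) • S k) (Real.exp (δ l * s) • S l)) := by
    exact realisable_polarGram (fun l => Real.exp (δ l * s) • S l) (fun l => (hS l).smul _)
  have h2 := realisable_smul r h1
  convert h2 using 1
  ext k l
  simp only [Matrix.of_apply, Matrix.smul_apply, smul_eq_mul, polar_smul_left_right, pairExp]
  rw [add_mul, Real.exp_add]
  ring

/-- **S3c.**  From the zero data (S3a along a sequence) and the block data (S3b) build the cluster limit. [folklore] -/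
theorem clusterLimit_of_data (δstar : Fin 6 → ℝ) (δseq : ℕ → Fin 6 → ℝ)
    (hδ : ∀ l, Tendsto (fun ν => δseq ν l) atTop (𝓝 (δstar l)))
    (S : ℕ → Fin 6 → Matrix (Fin 2) (Fin 2) ℝ) (hS : ∀ ν l, (S ν l).IsSymm)
    (hG0 : ∀ ν, (fun p : Pair => polar (S ν p.1) (S ν p.2)) ≠ 0)
    (z : ℕ → Fin 20 → ℝ) (hz : ∀ ν, StrictMono (z ν))
    (hzero : ∀ ν j, expSum (fun p : Pair => polar (S ν p.1) (S ν p.2)) (pairExp (δseq ν)) (z ν j) = 0)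
    (C : ℕ) (start : Fin C → Fin 20) (blk : Fin 20 → Fin C) (R : ℝ)
    (hwin : ∀ ν j, z ν j - z ν (start (blk j)) ∈ Set.Icc (-R) R)
    (hdrift : ∀ c c', c < c' → Tendsto (fun ν => z ν (start c') - z ν (start c)) atTop atTop) :
    Nonempty (ClusterLimit δstar) := by
  classical
  -- Gram vectors, centres, recentred vectors, norms, normalised vectors
  let G : ℕ → Pair → ℝ := fun ν p => polar (S ν p.1) (S ν p.2)
  let s : Fin C → ℕ → ℝ := fun c ν => z ν (start c)
  let b : Fin C → ℕ → Pair → ℝ := fun c ν p => G ν p * Real.exp (pairExp (δseq ν) p * s c ν)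
  have hb0 : ∀ c ν, b c ν ≠ 0 := by
    intro c ν hb
    apply hG0 ν
    funext p
    have := congrFun hb p
    simp only [b, Pi.zero_apply, mul_eq_zero, Real.exp_ne_zero, or_false] at this
    simpa [G] using this
  let N : Fin C → ℕ → ℝ := fun c ν => ‖b c ν‖
  have hNpos : ∀ c ν, 0 < N c ν := fun c ν => norm_pos_iff.mpr (hb0 c ν)
  let a : Fin C → ℕ → Pair → ℝ := fun c ν p => (N c ν)⁻¹ * (G ν p * Real.exp (pairExp (δseq ν) p * s c ν))
  have ha_eq : ∀ c ν, a c ν = (N c ν)⁻¹ • b c ν := by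
    intro c ν; funext p; simp only [a, b, Pi.smul_apply, smul_eq_mul]
  have hnorm_a : ∀ c ν, ‖a c ν‖ = 1 := by
    intro c ν
    rw [ha_eq, norm_smul, norm_inv, Real.norm_of_nonneg (norm_nonneg _)]
    exact inv_mul_cancel₀ (hNpos c ν).ne'
  have hbound : ∀ c ν p, |a c ν p| ≤ 1 := by
    intro c ν p
    have := norm_le_pi_norm (a c ν) p
    rw [Real.norm_eq_abs, hnorm_a] at this
    exact this
  -- Bolzano–Weierstrass in `Fin C → Pair → ℝ`
  let A : ℕ → (Fin C → Pair → ℝ) := fun ν c => a c ν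
  have hAball : ∀ ν, A ν ∈ Metric.closedBall (0 : Fin C → Pair → ℝ) 1 := by
    intro ν
    rw [Metric.mem_closedBall, dist_zero_right]
    refine (pi_norm_le_iff_of_nonneg zero_le_one).mpr fun c => ?_
    exact (hnorm_a c ν).le
  obtain ⟨Hfull, -, ψ, hψ, hlim⟩ := tendsto_subseq_of_bounded Metric.isBounded_closedBall hAball
  have hlim_c : ∀ c, Tendsto (fun ν => a c (ψ ν)) atTop (𝓝 (Hfull c)) := fun c =>
    (tendsto_pi_nhds.mp hlim) c
  have hlim_cp : ∀ c p, Tendsto (fun ν => a c (ψ ν) p) atTop (𝓝 (Hfull c p)) := fun c p =>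
    (tendsto_pi_nhds.mp (hlim_c c)) p
  have hHne : ∀ c, Hfull c ≠ 0 := by
    intro c
    have h1 : Tendsto (fun ν => ‖a c (ψ ν)‖) atTop (𝓝 ‖Hfull c‖) := (hlim_c c).norm
    have h2 : Tendsto (fun ν => ‖a c (ψ ν)‖) atTop (𝓝 1) := by
      simp only [hnorm_a]; exact tendsto_const_nhds
    have : ‖Hfull c‖ = 1 := tendsto_nhds_unique h1 h2
    intro h0
    rw [h0, norm_zero] at this
    exact zero_ne_one this
  -- the structure
  refine ⟨{
    C := C
    m := fun c => (Finset.univ.filter fun j : Fin 20 => blk j = c).card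
    hm := ?_
    δseq := fun ν => δseq (ψ ν)
    hδ := fun l => (hδ l).comp hψ.tendsto_atTop
    a := fun c ν => a c (ψ ν)
    H := Hfull
    ha := hlim_cp
    hbound := fun c ν p => hbound c (ψ ν) p
    hH := hHne
    hreal := ?_
    R := fun _ => R
    hzeros := ?_
    L := fun c c' ν => s c' (ψ ν) - s c (ψ ν)
    ρ := fun c c' ν => N c (ψ ν) / N c' (ψ ν)
    hρ := fun c c' ν => div_pos (hNpos c _) (hNpos c' _)
    hL := fun c c' hcc' => (hdrift c c' hcc').comp hψ.tendsto_atTop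
    htransfer := ?_ }⟩
  · -- ∑ m c = 20
    have := Finset.card_eq_sum_card_fiberwise (f := blk) (s := (Finset.univ : Finset (Fin 20)))
      (t := (Finset.univ : Finset (Fin C))) (fun _ _ => Finset.mem_univ _)
    rw [Finset.card_univ, Fintype.card_fin] at this
    exact this.symm
  · -- realisability of the limits (B11)
    intro c
    refine realisable_of_tendsto (Gseq := fun ν => Matrix.of fun k l => a c (ψ ν) (k, l)) ?_ ?_
    · intro ν
      exact realisable_recentred (δseq (ψ ν)) (S (ψ ν)) (hS (ψ ν)) (N c (ψ ν))⁻¹ (s c (ψ ν))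
    · exact tendsto_pi_nhds.mpr fun k => tendsto_pi_nhds.mpr fun l => hlim_cp c (k, l)
  · -- the zeros of cluster `c` in the window
    intro c ν
    refine ⟨(Finset.univ.filter fun j : Fin 20 => blk j = c).image fun j => z (ψ ν) j - s c (ψ ν), ?_, ?_⟩
    · rw [Finset.card_image_of_injective]
      intro j j' h
      exact (hz (ψ ν)).injective (sub_left_injective h)
    · intro w hw
      obtain ⟨j, hj, rfl⟩ := Finset.mem_image.mp hw
      have hjc : blk j = c := (Finset.mem_filter.mp hj).2
      refine ⟨?_, ?_⟩
      · have := hwin (ψ ν) j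
        rw [hjc] at this
        exact this
      · show expSum (a c (ψ ν)) (pairExp (δseq (ψ ν))) (z (ψ ν) j - s c (ψ ν)) = 0
        rw [show a c (ψ ν) = fun p => (N c (ψ ν))⁻¹ * (G (ψ ν) p * Real.exp (pairExp (δseq (ψ ν)) p * s c (ψ ν)))
          from rfl, expSum_recenter, sub_add_cancel, hzero, mul_zero]
  · -- the transfer identity between clusters
    intro c c' _ ν p
    show a c' (ψ ν) p = a c (ψ ν) p * Real.exp (pairExp (δseq (ψ ν)) p * (s c' (ψ ν) - s c (ψ ν)))
      * (N c (ψ ν) / N c' (ψ ν))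
    simp only [a]
    have hN := (hNpos c (ψ ν)).ne'
    have hN' := (hNpos c' (ψ ν)).ne'
    rw [mul_sub, Real.exp_sub]
    field_simp

/-! ## S3 and obligation (B) -/

/-- **S3.**  Every `δ⋆` in the closure of the twenty-locus carries cluster-limit data. [folklore] -/
theorem clusterLimit_of_mem_closure :
    ∀ δstar : Fin 6 → ℝ, δstar ∈ closure TwentyLocus → Nonempty (ClusterLimit δstar) := by
  intro δstar hclos
  obtain ⟨δseq₀, hmem, hlim₀⟩ := mem_closure_iff_seq_limit.mp hclos
  -- S3a at every `ν`
  choose S hS hG0 z hz hzero using fun ν => zeros_of_mem_twentyLocus (hmem ν)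
  -- S3b
  obtain ⟨φ, hφ, C, start, blk, R, -, -, hwin, hdrift⟩ := blocks z hz
  -- S3c along `φ`
  have hδ : ∀ l, Tendsto (fun ν => δseq₀ (φ ν) l) atTop (𝓝 (δstar l)) := fun l =>
    ((tendsto_pi_nhds.mp hlim₀) l).comp hφ.tendsto_atTop
  exact clusterLimit_of_data δstar (fun ν => δseq₀ (φ ν)) hδ (fun ν => S (φ ν)) (fun ν => hS (φ ν))
    (fun ν => hG0 (φ ν)) (fun ν => z (φ ν)) (fun ν => hz (φ ν)) (fun ν => hzero (φ ν)) C start blk R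
    (fun ν j => hwin ν j) hdrift

/-- **Obligation (B) `Stmt.stub_bubbling` (verbatim copy) — PROVED from Parts I–VI.** [this work] -/
theorem stub_bubbling_proof : Stmt.stub_bubbling :=
  stub_bubbling_of clusterLimit_of_mem_closure

/-- **Obligation (B), every project definition unfolded** (only Mathlib notions in the statement). [this work] -/
theorem stub_bubbling_inlined :
    ∀ δ : Fin 6 → ℝ, (Monotone δ ∧ δ 0 = 0 ∧ δ (Fin.last 5) = 1) →
      δ ∈ closure {δ' : Fin 6 → ℝ | ∃ S : Fin 6 → Matrix (Fin 2) (Fin 2) ℝ, (∀ l, (S l).IsSymm) ∧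
        20 ≤ {x : ℝ | 0 < x ∧ (∑ l, (x ^ (δ' l)) • S l).det = 0}.ncard} →
      (∃ i j k l : Fin 6, (i, j) ≠ (k, l) ∧ (i, j) ≠ (l, k) ∧ δ i + δ j = δ k + δ l) →
        ∃ G : Matrix (Fin 6) (Fin 6) ℝ, G ≠ 0 ∧
          (∀ v : ℝ, (∑ k, ∑ l, if δ k + δ l = v then G k l else 0) = 0) ∧
          ∃ (ε : ℝ) (S : Fin 6 → Matrix (Fin 2) (Fin 2) ℝ), (ε = 1 ∨ ε = -1) ∧ (∀ l, (S l).IsSymm) ∧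
            ∀ i j, G i j = ε * (((S i + S j).det - (S i).det - (S j).det) / 2) :=
  fun δ h₁ h₂ h₃ => stub_bubbling_proof δ h₁ h₂ h₃

end Summit.ValiantsHypothesis.ValiantsHypothesis.Theorems.LacunarySymmetroidMatrixDescartes.WallBubbling.Bubbling
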